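import Summits.CriticalPhenomena.PercolationContinuityZ3.Theorems.Transplant.SkelFrmBParamsCorr
import Summits.CriticalPhenomena.PercolationContinuityZ3.Theorems.Transplant.SkelNegBParamsCorr
import Summits.CriticalPhenomena.PercolationContinuityZ3.Theorems.Transplant.SkelFrm1ParamsCorrOK
import Summits.CriticalPhenomena.PercolationContinuityZ3.Theorems.Transplant.SkelNeg1ParamsCorrOK
import Summits.CriticalPhenomena.PercolationContinuityZ3.Theorems.Transplant.SkelNegBParamsCorrOK
import Summits.CriticalPhenomena.PercolationContinuityZ3.Theorems.Transplant.PlanarSkeletonFrmDefs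
import Summits.CriticalPhenomena.PercolationContinuityZ3.Theorems.Transplant.SkelPhiStepIDataNS
import HarnessLib

/-!
# N2 (frames-only node `SamePDropOfSkeletonFrm₁`, OPEN) params column over `PlanarSkeletonFrm` — (ζ″) ledger, shape (B′) of record ((R-14)):
# MECHANICAL PORT of N1's `SkelNegBParamsCorrOK` — chain of record `NegB` (box slot `g`; re-version of `SkelNeg1ParamsCorrOK` p285935), part 5b (O-level, (C) column): THE
# TWO ESTIMATE FIELDS OF `LocOK` FOR THE PHASE-1 RECORD OF RECORD — `0 ≤ sLo` and `e ≤ sLo` ("kit depth + reading slack < cells per v-stride"), hence **`Neg.locOK₁ :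
# ChainPara.LocOK … (N1 title abridged; see `SkelNegBParamsCorrOK`)
builds on p205010 (kernel theorem, internal audit signed; external expert review pending) — nothing in this file uses p205010; NOTHING is claimed about the
open node `SamePDropOfSkeletonFrm₁` (`SamePDropOfSkeletonNeg₁` is CLOSED in the tree and untouched by this file).
Status sentence (coordinator 2026-08-20T04:30Z): "θ(p_c) = 0 on ℤ^d, all d ≥ 2 — kernel-verified (Lean 4/Mathlib, standard axioms); internal adversarial
audit SIGNED 2026-08-20 04:29Z; external expert review pending."
Lane `prim-bschramm-*`, seat `prim-bschramm-stmt` (gen 19); helper file (`--supports stmt-CriticalPhenomena-4575 --as helper`); ledger HOME/prim-bschramm-stmt/FRM-PARAMS.md §9, (R-14).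
PORT RULES (HOME/prim-bschramm-stmt-g19/lean/port_frm.py, the tool of record per (R-14)): outer namespace `PlanarSkeletonNeg ↦ PlanarSkeletonFrm`, carrier binder
`(Φ : PlanarSkeletonFrm G)`, record binder `(D : Skelφ.StepI.DataNS V)` (the selectors travel IN the record, `SkelPhiStepIDataNS`); section variables INLINED into every
declaration header; inner namespaces (`Neg`/`NegB`/`KS`/…) and every short name KEPT so all cross-references resolve unchanged; declarations using no section variable are
NOT re-declared (N1's originals are referenced fully qualified). Mathematical content, proofs, docstrings and citations are N1's, verbatim, except where stated next.
SELECTORS IN THIS FILE ((R-14) condition of record — joint selection, `D.sN`'s first argument is the literal handed to `D.sM`): none (pure port; the pairs are read through their N1 names).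
N1 HEADER (kept for the reader):
helper file (`--supports stmt-CriticalPhenomena-4575 --as helper`); ledger HOME/prim-bschramm-stmt/NEG-PARAMS.md v0.9 §1C;
p5-g8 2026-08-21T15:15:39Z ((1) `z` is O(1) — here: `z ≤ 12`; (2) `e := z + R′`).
THE TWO ESTIMATES.  (i) **`z ≤ 12`**: at the split point `v = v_α` each transverse numerator is `v_α·(m − β)` with `β ∈ {β_lo, β_hi}` (`max`/`min` is one of the two), and
`|m − β_hi| < n`, `|m − β_lo| ≤ n + |h| − 1` (top layer `nℓ − n < m ≤ nℓ`), so `|numerator| ≤ 11·n·|v_α|` by `|h| ≤ 10n`; the inner floor `⌊800·(…)/n⌋` is then within `±8800|v_α|`,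
and `c₀·8800·|v_α| = 11·(16000·K·(m₀−1)·|v_α|) ≤ 11·D` by the resolution inequality `16000·K·(m₀−1)·(|v_β|+|v_α|) ≤ D` (`cL_le_D_fcells_at`), so `|Trd| ≤ 11`.
(ii) **`X ≤ aLo` whenever `33·X + 11 ≤ ℓ_L`**: `D < 16000·K·(n+|h|)·(m₁+1)` (definition of `m₁`), `m₁ + 1 = (m₁ − 1) + 2 ≤ 3(m₁ − 1)`, so `X·D ≤ 16000·K·(m₁−1)·β_lo = c₁·800·β_lo` as
soon as `3·X·(n+|h|) ≤ β_lo`, i.e. `33·X·n ≤ nℓ − 11n + 1`.  With `X := R′ + 14` this needs `ℓ_L ≥ 33R′ + 473`, implied by `ℓ_L > M_L ≥ 4K(R′+2) ≥ 160R′ + 320` and `R′ ≥ 3`.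
* §1 `U_le` (`n + |h| ≤ 11n`), `md_layer`, `abs_num_core`, the four `abs_num_…`, `abs_Trd_le`, **`zC_le`** (`z ≤ 12`);
* §2 `Dd_lt` (`D < 16000·K·L̂₁·(s₁+2)`), **`le_aLo`**, `ℓL_ge` (`160·R′ + 321 ≤ ℓ_L`), `three_le_R'`;
* §3 **`locOK_hs0_at`**, **`e_lt_sLo_at`**, **`locOK_he_at`**, **`locOK₁`**, `hN₁` (the rounds inequality, unconditional form).
[cite: KozmaNitzan2024, §4 Lemma 12 (pp. 23–25)] [cite: MartineauTassion2017, §4.3 Lemma 4.2]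
-/

noncomputable section

open scoped Classical

namespace Summit.CriticalPhenomena.PercolationContinuityZ3.Theorems.Transplant

namespace PlanarSkeletonFrm

namespace NegB

open Literature.Probability.Percolation Literature.Probability.LatticeModels SimpleGraph
open SkelConc (Consts)
open Neg
open TwoAxis.Para (modulus)

section CorrOK

/-! ## §1 The reading slack is at most `12` -/

/-- `n + |h| ≤ 11·n` under the shear bound of the chosen orientation. [folklore] -/
theorem U_le (κ : Consts) {V : Type} [DecidableEq V] [Countable V] {G : SimpleGraph V} [G.LocallyFinite] (Φ : PlanarSkeletonFrm G) (t : V) (p : unitInterval) (D : Skelφ.StepI.DataNS V) (g : ℕ) (f : ℕ) (hκ : (hL κ Φ t p D g f).natAbs ≤ 10 * nL κ Φ t p D g f) : ((nL κ Φ t p D g f + (hL κ Φ t p D g f).natAbs : ℕ) : ℤ) ≤ 11 * (nL κ Φ t p D g f : ℤ) := by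
  have : nL κ Φ t p D g f + (hL κ Φ t p D g f).natAbs ≤ 11 * nL κ Φ t p D g f := by omega
  exact_mod_cast this

/-- `n + |h|` in `ℤ` is `n + |h|`. [folklore] -/
theorem U_eq (κ : Consts) {V : Type} [DecidableEq V] [Countable V] {G : SimpleGraph V} [G.LocallyFinite] (Φ : PlanarSkeletonFrm G) (t : V) (p : unitInterval) (D : Skelφ.StepI.DataNS V) (g : ℕ) (f : ℕ) : ((nL κ Φ t p D g f + (hL κ Φ t p D g f).natAbs : ℕ) : ℤ) = (nL κ Φ t p D g f : ℤ) + |hL κ Φ t p D g f| := by push_cast; rfl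

/-- The top layer: `nℓ − n < m ≤ nℓ`. [folklore] -/
theorem md_layer (κ : Consts) {V : Type} [DecidableEq V] [Countable V] {G : SimpleGraph V} [G.LocallyFinite] (Φ : PlanarSkeletonFrm G) (t : V) (p : unitInterval) (D : Skelφ.StepI.DataNS V) (g : ℕ) (f : ℕ) (hN : EqNumL κ Φ t p D g f) :
    (nL κ Φ t p D g f : ℤ) * ℓL κ Φ t p D g f - nL κ Φ t p D g f < md κ Φ t p D g f ∧ md κ Φ t p D g f ≤ (nL κ Φ t p D g f : ℤ) * ℓL κ Φ t p D g f :=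
  Skelφ.NegPrm.modulus_vβOf (one_le_of_eqNumL κ Φ t p D g f hN).1 _ _ _

/-- **The core cancellation**: for `β ∈ {β_lo, β_hi}`, `|m·v_α − v_α·β| ≤ 11·n·|v_α|`. [this work] -/
theorem abs_num_core (κ : Consts) {V : Type} [DecidableEq V] [Countable V] {G : SimpleGraph V} [G.LocallyFinite] (Φ : PlanarSkeletonFrm G) (t : V) (p : unitInterval) (D : Skelφ.StepI.DataNS V) (g : ℕ) (f : ℕ) (hN : EqNumL κ Φ t p D g f) (hκ : (hL κ Φ t p D g f).natAbs ≤ 10 * nL κ Φ t p D g f) {β : ℤ}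
    (hβ : β = βlo κ Φ t p D g f ∨ β = βhi κ Φ t p D g f) : |md κ Φ t p D g f * vL κ Φ t p D g f - vL κ Φ t p D g f * β| ≤ 11 * (nL κ Φ t p D g f : ℤ) * |vL κ Φ t p D g f| := by
  obtain ⟨h1, h2⟩ := md_layer κ Φ t p D g f hN
  have hU := U_le κ Φ t p D g f hκ
  have hU1 : (1 : ℤ) ≤ ((nL κ Φ t p D g f + (hL κ Φ t p D g f).natAbs : ℕ) : ℤ) := by
    have : 1 ≤ nL κ Φ t p D g f + (hL κ Φ t p D g f).natAbs := le_add_right (one_le_of_eqNumL κ Φ t p D g f hN).1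
    exact_mod_cast this
  have hmβ : |md κ Φ t p D g f - β| ≤ 11 * (nL κ Φ t p D g f : ℤ) := by
    rw [abs_le]
    rcases hβ with rfl | rfl
    · unfold βlo; constructor <;> linarith
    · unfold βhi; constructor <;> linarith
  have e : md κ Φ t p D g f * vL κ Φ t p D g f - vL κ Φ t p D g f * β = vL κ Φ t p D g f * (md κ Φ t p D g f - β) := by ring
  rw [e, abs_mul]
  nlinarith [abs_nonneg (vL κ Φ t p D g f), abs_nonneg (md κ Φ t p D g f - β)]

/-- The four numerators: `|m·x − B| ≤ 11·n·|v_α|` for `(x, B) = (v, Bmin), (v, Bmax), (−v, Bmin′), (−v, Bmax′)`. [folklore] -/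
theorem abs_num_four (κ : Consts) {V : Type} [DecidableEq V] [Countable V] {G : SimpleGraph V} [G.LocallyFinite] (Φ : PlanarSkeletonFrm G) (t : V) (p : unitInterval) (D : Skelφ.StepI.DataNS V) (g : ℕ) (f : ℕ) (hN : EqNumL κ Φ t p D g f) (hκ : (hL κ Φ t p D g f).natAbs ≤ 10 * nL κ Φ t p D g f) :
    |md κ Φ t p D g f * vL κ Φ t p D g f - Bmin κ Φ t p D g f| ≤ 11 * (nL κ Φ t p D g f : ℤ) * |vL κ Φ t p D g f| ∧
      |md κ Φ t p D g f * vL κ Φ t p D g f - Bmax κ Φ t p D g f| ≤ 11 * (nL κ Φ t p D g f : ℤ) * |vL κ Φ t p D g f| ∧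
      |md κ Φ t p D g f * -vL κ Φ t p D g f - Bmin' κ Φ t p D g f| ≤ 11 * (nL κ Φ t p D g f : ℤ) * |vL κ Φ t p D g f| ∧
      |md κ Φ t p D g f * -vL κ Φ t p D g f - Bmax' κ Φ t p D g f| ≤ 11 * (nL κ Φ t p D g f : ℤ) * |vL κ Φ t p D g f| := by
  have hlo := abs_num_core κ Φ t p D g f hN hκ (Or.inl rfl)
  have hhi := abs_num_core κ Φ t p D g f hN hκ (Or.inr rfl)
  -- mirrored numerators are negatives of the direct ones
  have mir : ∀ β : ℤ, md κ Φ t p D g f * -vL κ Φ t p D g f - vL κ Φ t p D g f * -β = -(md κ Φ t p D g f * vL κ Φ t p D g f - vL κ Φ t p D g f * β) := by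
    intro β; ring
  refine ⟨?_, ?_, ?_, ?_⟩
  · unfold Bmin
    rcases min_choice (vL κ Φ t p D g f * βlo κ Φ t p D g f) (vL κ Φ t p D g f * βhi κ Φ t p D g f) with h | h <;> rw [h]
    · exact hlo
    · exact hhi
  · unfold Bmax
    rcases max_choice (vL κ Φ t p D g f * βlo κ Φ t p D g f) (vL κ Φ t p D g f * βhi κ Φ t p D g f) with h | h <;> rw [h]
    · exact hlo
    · exact hhi
  · unfold Bmin'
    rcases min_choice (vL κ Φ t p D g f * -βhi κ Φ t p D g f) (vL κ Φ t p D g f * -βlo κ Φ t p D g f) with h | h <;> rw [h, mir, abs_neg]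
    · exact hhi
    · exact hlo
  · unfold Bmax'
    rcases max_choice (vL κ Φ t p D g f * -βhi κ Φ t p D g f) (vL κ Φ t p D g f * -βlo κ Φ t p D g f) with h | h <;> rw [h, mir, abs_neg]
    · exact hhi
    · exact hlo

/-- **`|Trd x B| ≤ 11`** whenever `|m·x − B| ≤ 11·n·|v_α|` (inner floor within `±8800|v_α|`, then `c₀·8800|v_α| ≤ 11·D`). [this work] -/
theorem abs_Trd_le (κ : Consts) {V : Type} [DecidableEq V] [Countable V] {G : SimpleGraph V} [G.LocallyFinite] (Φ : PlanarSkeletonFrm G) (t : V) (p : unitInterval) (D : Skelφ.StepI.DataNS V) (g : ℕ) (f : ℕ) (hN : EqNumL κ Φ t p D g f) {x B : ℤ} (hB : |md κ Φ t p D g f * x - B| ≤ 11 * (nL κ Φ t p D g f : ℤ) * |vL κ Φ t p D g f|) :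
    |Trd κ Φ t p D g f x B| ≤ 11 := by
  have hn1 : (1 : ℤ) ≤ nL κ Φ t p D g f := by exact_mod_cast (one_le_of_eqNumL κ Φ t p D g f hN).1
  have hn0 : (0 : ℤ) < nL κ Φ t p D g f := by linarith
  have hD := Dd_pos κ Φ t p D g f hN
  have hc0 : 0 ≤ c0 κ Φ t p D g f := (c_nonneg' κ Φ t p D g f).1
  -- inner floor
  set q : ℤ := 800 * (md κ Φ t p D g f * x - B) / (nL κ Φ t p D g f : ℤ) with hq
  have hB' := abs_le.1 hB
  have hq1 : q ≤ 8800 * |vL κ Φ t p D g f| := by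
    rw [hq]; refine Int.ediv_le_of_le_mul hn0 ?_; nlinarith [hB'.2]
  have hq2 : -(8800 * |vL κ Φ t p D g f|) ≤ q := by
    rw [hq]; refine Int.le_ediv_of_mul_le hn0 ?_; nlinarith [hB'.1]
  -- the resolution inequality `c₀·800·(|vβ|+|vα|) ≤ D`
  have hres := (cL_le_D_fcells_at κ Φ t p D g f hN).1
  rw [(fcells_K κ Φ t p D g f).1] at hres
  have e8 : |(800 : ℤ)| = 800 := abs_of_nonneg (by norm_num)
  rw [e8] at hres
  have hc0' : c0 κ Φ t p D g f = 20 * (Neg.K κ : ℤ) * (((fcells κ Φ t p D g f).s 0 : ℕ) : ℤ) := by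
    unfold c0; rw [(fcells_K κ Φ t p D g f).1]
  have hres' : c0 κ Φ t p D g f * (800 * |vL κ Φ t p D g f|) ≤ Dd κ Φ t p D g f := by
    rw [hc0']
    have : 20 * (Neg.K κ : ℤ) * (((fcells κ Φ t p D g f).s 0 : ℕ) : ℤ) * (800 * |vL κ Φ t p D g f|) ≤
        20 * (Neg.K κ : ℤ) * (((fcells κ Φ t p D g f).s 0 : ℕ) : ℤ) * (800 * (|vβL κ Φ t p D g f| + |vL κ Φ t p D g f|)) := by
      have hK : (0 : ℤ) ≤ 20 * (Neg.K κ : ℤ) * (((fcells κ Φ t p D g f).s 0 : ℕ) : ℤ) := by positivity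
      exact mul_le_mul_of_nonneg_left (by linarith [abs_nonneg (vβL κ Φ t p D g f)]) hK
    exact this.trans hres
  -- outer floor
  unfold Trd
  rw [← hq, abs_le]
  constructor
  · refine Int.le_ediv_of_mul_le hD ?_
    nlinarith [mul_le_mul_of_nonneg_left hq2 hc0]
  · refine Int.ediv_le_of_le_mul hD ?_
    nlinarith [mul_le_mul_of_nonneg_left hq1 hc0]

/-- **THE READING SLACK IS AT MOST `12`**. [this work] -/
theorem zC_le (κ : Consts) {V : Type} [DecidableEq V] [Countable V] {G : SimpleGraph V} [G.LocallyFinite] (Φ : PlanarSkeletonFrm G) (t : V) (p : unitInterval) (D : Skelφ.StepI.DataNS V) (g : ℕ) (f : ℕ) (hN : EqNumL κ Φ t p D g f) (hκ : (hL κ Φ t p D g f).natAbs ≤ 10 * nL κ Φ t p D g f) : zC κ Φ t p D g f ≤ 12 := by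
  obtain ⟨b1, b2, b3, b4⟩ := abs_num_four κ Φ t p D g f hN hκ
  have t1 := abs_le.1 (abs_Trd_le κ Φ t p D g f hN b1)
  have t2 := abs_le.1 (abs_Trd_le κ Φ t p D g f hN b2)
  have t3 := abs_le.1 (abs_Trd_le κ Φ t p D g f hN b3)
  have t4 := abs_le.1 (abs_Trd_le κ Φ t p D g f hN b4)
  unfold zC
  have : (max (max (Trd κ Φ t p D g f (vL κ Φ t p D g f) (Bmin κ Φ t p D g f) + 1) (Trd κ Φ t p D g f (-vL κ Φ t p D g f) (Bmin' κ Φ t p D g f) + 1))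
      (max (-Trd κ Φ t p D g f (vL κ Φ t p D g f) (Bmax κ Φ t p D g f)) (-Trd κ Φ t p D g f (-vL κ Φ t p D g f) (Bmax' κ Φ t p D g f)))) ≤ 12 := by
    refine max_le (max_le ?_ ?_) (max_le ?_ ?_) <;> linarith [t1.2, t2.1, t3.2, t4.1]
  omega

/-! ## §2 The along floor: cells per v-stride -/

/-- **`D < 16000·K·(n+|h|)·(s₁ + 2)`** from the definition of `m₁` (`s₁ = m₁ − 1`). [folklore] -/
theorem Dd_lt (κ : Consts) {V : Type} [DecidableEq V] [Countable V] {G : SimpleGraph V} [G.LocallyFinite] (Φ : PlanarSkeletonFrm G) (t : V) (p : unitInterval) (D : Skelφ.StepI.DataNS V) (g : ℕ) (f : ℕ) (hN : EqNumL κ Φ t p D g f) :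
    Dd κ Φ t p D g f < 20 * (Neg.K κ : ℤ) * (800 * ((nL κ Φ t p D g f : ℤ) + |hL κ Φ t p D g f|)) * ((((fcells κ Φ t p D g f).s 1 : ℕ) : ℤ) + 2) := by
  have hn1 : (1 : ℤ) ≤ nL κ Φ t p D g f := by exact_mod_cast (one_le_of_eqNumL κ Φ t p D g f hN).1
  have hK : (1 : ℤ) ≤ Neg.K κ := by exact_mod_cast (Neg.forty_le_K κ).2.2
  have hb : (0 : ℤ) < 20 * (Neg.K κ : ℤ) * (800 * Skelφ.NegPrm.L1hat (nL κ Φ t p D g f) (hL κ Φ t p D g f)) := by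
    unfold Skelφ.NegPrm.L1hat; have := abs_nonneg (hL κ Φ t p D g f); positivity
  have key := Int.lt_ediv_add_one_mul_self (Dd κ Φ t p D g f) hb
  have hs1 : (((fcells κ Φ t p D g f).s 1 : ℕ) : ℤ) + 2 = m1 κ Φ t p D g f + 1 := by
    rw [(fcells_s_at κ Φ t p D g f hN).2]; unfold fm1; ring
  have hm1 : m1 κ Φ t p D g f = Dd κ Φ t p D g f / (20 * (Neg.K κ : ℤ) * (800 * Skelφ.NegPrm.L1hat (nL κ Φ t p D g f) (hL κ Φ t p D g f))) := rfl
  rw [hs1, hm1]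
  have eL : ((nL κ Φ t p D g f : ℤ) + |hL κ Φ t p D g f|) = Skelφ.NegPrm.L1hat (nL κ Φ t p D g f) (hL κ Φ t p D g f) := rfl
  rw [eL]
  linarith [key]

/-- **`X ≤ aLo` whenever `0 ≤ X` and `33·X + 11 ≤ ℓ_L`** (and the shear bound). [this work] -/
theorem le_aLo (κ : Consts) {V : Type} [DecidableEq V] [Countable V] {G : SimpleGraph V} [G.LocallyFinite] (Φ : PlanarSkeletonFrm G) (t : V) (p : unitInterval) (D : Skelφ.StepI.DataNS V) (g : ℕ) (f : ℕ) (hN : EqNumL κ Φ t p D g f) (hκ : (hL κ Φ t p D g f).natAbs ≤ 10 * nL κ Φ t p D g f) {X : ℤ} (hX : 0 ≤ X)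
    (hℓ : 33 * X + 11 ≤ (ℓL κ Φ t p D g f : ℤ)) : X ≤ aLo κ Φ t p D g f := by
  have hn1 : (1 : ℤ) ≤ nL κ Φ t p D g f := by exact_mod_cast (one_le_of_eqNumL κ Φ t p D g f hN).1
  have hD := Dd_pos κ Φ t p D g f hN
  have hK : (1 : ℤ) ≤ Neg.K κ := by exact_mod_cast (Neg.forty_le_K κ).2.2
  have hs1 : (1 : ℤ) ≤ (((fcells κ Φ t p D g f).s 1 : ℕ) : ℤ) := by exact_mod_cast (fcells κ Φ t p D g f).hs 1
  have hU := U_le κ Φ t p D g f hκ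
  have hUe := U_eq κ Φ t p D g f
  have hlt := Dd_lt κ Φ t p D g f hN
  set s1 : ℤ := (((fcells κ Φ t p D g f).s 1 : ℕ) : ℤ) with hs1d
  set U : ℤ := (nL κ Φ t p D g f : ℤ) + |hL κ Φ t p D g f| with hUd
  have hU' : U ≤ 11 * (nL κ Φ t p D g f : ℤ) := by rw [← hUe]; exact hU
  have hU0 : 1 ≤ U := by rw [hUd]; linarith [abs_nonneg (hL κ Φ t p D g f)]
  -- `β_lo ≥ n(ℓ − 11) + 1 ≥ 33 X n ≥ 3 X U`
  have hβ : βlo κ Φ t p D g f = (nL κ Φ t p D g f : ℤ) * ℓL κ Φ t p D g f - U + 1 := by unfold βlo; rw [hUe]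
  have hc1 : c1 κ Φ t p D g f = 20 * (Neg.K κ : ℤ) * s1 := by unfold c1; rw [(fcells_K κ Φ t p D g f).1]
  unfold aLo
  refine Int.le_ediv_of_mul_le hD ?_
  rw [hc1, hβ]
  -- X·D ≤ X·(16000 K U (s1+2)) ≤ 16000 K s1 (nℓ − U + 1)
  have step1 : X * Dd κ Φ t p D g f ≤ X * (20 * (Neg.K κ : ℤ) * (800 * U) * (s1 + 2)) := mul_le_mul_of_nonneg_left hlt.le hX
  have step2 : X * U * (s1 + 2) ≤ s1 * ((nL κ Φ t p D g f : ℤ) * ℓL κ Φ t p D g f - U + 1) := by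
    have a1 : X * U * (s1 + 2) ≤ 3 * X * U * s1 := by nlinarith [mul_nonneg hX (by linarith : (0 : ℤ) ≤ U)]
    have a2 : 3 * X * U ≤ 33 * X * (nL κ Φ t p D g f : ℤ) := by nlinarith
    have a3 : 33 * X * (nL κ Φ t p D g f : ℤ) ≤ (nL κ Φ t p D g f : ℤ) * ℓL κ Φ t p D g f - U + 1 := by nlinarith
    nlinarith
  have hK0 : (0 : ℤ) ≤ 20 * (Neg.K κ : ℤ) * 800 := by positivity
  nlinarith [mul_le_mul_of_nonneg_left step2 hK0]

/-- `160·R′ + 321 ≤ ℓ_L` (`M_L + 1 ≤ ℓ_L`, `4K(R′+2) ≤ M_L`, `K ≥ 40`). [folklore] -/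
theorem ℓL_ge (κ : Consts) {V : Type} [DecidableEq V] [Countable V] {G : SimpleGraph V} [G.LocallyFinite] (Φ : PlanarSkeletonFrm G) (t : V) (p : unitInterval) (D : Skelφ.StepI.DataNS V) (g : ℕ) (f : ℕ) (hN : EqNumL κ Φ t p D g f) : 160 * (R' κ Φ t p D : ℤ) + 321 ≤ (ℓL κ Φ t p D g f : ℤ) := by
  have h1 := hN.ℓ_le
  have h2 : 4 * Neg.K κ * (R' κ Φ t p D + 2) ≤ ML κ Φ t p D g := (coarse_floor_le_ML κ Φ t p D g).1
  have h3 := (Neg.forty_le_K κ).1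
  have h4 : 160 * (R' κ Φ t p D + 2) ≤ ML κ Φ t p D g := le_trans (by nlinarith) h2
  have h5 : (160 : ℤ) * ((R' κ Φ t p D : ℤ) + 2) ≤ (ML κ Φ t p D g : ℤ) := by exact_mod_cast h4
  linarith

/-! ## §3 `LocOK` -/

/-- **`LocOK.hs0`**: `0 ≤ sLo` (`1 ≤ aLo`, i.e. `ℓ_L ≥ 44`). [this work] -/
theorem locOK_hs0_at (κ : Consts) {V : Type} [DecidableEq V] [Countable V] {G : SimpleGraph V} [G.LocallyFinite] (Φ : PlanarSkeletonFrm G) (t : V) (p : unitInterval) (D : Skelφ.StepI.DataNS V) (g : ℕ) (f : ℕ) (hN : EqNumL κ Φ t p D g f) (hκ : (hL κ Φ t p D g f).natAbs ≤ 10 * nL κ Φ t p D g f) : 0 ≤ (locPrm₁ κ Φ t p D g f).sLo := by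
  show 0 ≤ sLoC κ Φ t p D g f
  have hR : (3 : ℤ) ≤ R' κ Φ t p D := by exact_mod_cast three_le_R' κ Φ t p D
  have hℓ := ℓL_ge κ Φ t p D g f hN
  have h := le_aLo κ Φ t p D g f hN hκ (X := 1) (by norm_num) (by linarith)
  unfold sLoC; linarith

/-- **`e < sLo`**: kit depth + reading slack is STRICTLY below the minimal v-stride progress (`e ≤ R′ + 12`, `sLo ≥ R′ + 13`). [this work] -/
theorem e_lt_sLo_at (κ : Consts) {V : Type} [DecidableEq V] [Countable V] {G : SimpleGraph V} [G.LocallyFinite] (Φ : PlanarSkeletonFrm G) (t : V) (p : unitInterval) (D : Skelφ.StepI.DataNS V) (g : ℕ) (f : ℕ) (hN : EqNumL κ Φ t p D g f) (hκ : (hL κ Φ t p D g f).natAbs ≤ 10 * nL κ Φ t p D g f) :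
    ((locPrm₁ κ Φ t p D g f).e : ℤ) < (locPrm₁ κ Φ t p D g f).sLo := by
  show ((eC κ Φ t p D g f : ℕ) : ℤ) < sLoC κ Φ t p D g f
  have hz := zC_le κ Φ t p D g f hN hκ
  have hR := three_le_R' κ Φ t p D
  have hℓ := ℓL_ge κ Φ t p D g f hN
  have hR' : (3 : ℤ) ≤ R' κ Φ t p D := by exact_mod_cast hR
  have h := le_aLo κ Φ t p D g f hN hκ (X := (R' κ Φ t p D : ℤ) + 14) (by positivity) (by linarith)
  have he : ((eC κ Φ t p D g f : ℕ) : ℤ) ≤ (R' κ Φ t p D : ℤ) + 12 := by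
    unfold eC; push_cast
    have : (zC κ Φ t p D g f : ℤ) ≤ 12 := by exact_mod_cast hz
    linarith
  unfold sLoC; linarith

/-- **`LocOK.he`**: `e ≤ sLo`. [this work] -/
theorem locOK_he_at (κ : Consts) {V : Type} [DecidableEq V] [Countable V] {G : SimpleGraph V} [G.LocallyFinite] (Φ : PlanarSkeletonFrm G) (t : V) (p : unitInterval) (D : Skelφ.StepI.DataNS V) (g : ℕ) (f : ℕ) (hN : EqNumL κ Φ t p D g f) (hκ : (hL κ Φ t p D g f).natAbs ≤ 10 * nL κ Φ t p D g f) :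
    ((locPrm₁ κ Φ t p D g f).e : ℤ) ≤ (locPrm₁ κ Φ t p D g f).sLo := (e_lt_sLo_at κ Φ t p D g f hN hκ).le

/-- **THE PHASE-1 RECORD OF RECORD IS ADMISSIBLE**: `LocOK (locPrm₁ κ Φ t p D g f)` under the numeric long clause and the shear bound of the chosen orientation.
[cite: KozmaNitzan2024, §4 Lemma 12 (pp. 23–25)] -/
theorem locOK₁ (κ : Consts) {V : Type} [DecidableEq V] [Countable V] {G : SimpleGraph V} [G.LocallyFinite] (Φ : PlanarSkeletonFrm G) (t : V) (p : unitInterval) (D : Skelφ.StepI.DataNS V) (g : ℕ) (f : ℕ) (hN : EqNumL κ Φ t p D g f) (hκ : (hL κ Φ t p D g f).natAbs ≤ 10 * nL κ Φ t p D g f) : ChainPara.LocOK (locPrm₁ κ Φ t p D g f) :=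
  locOK_of κ Φ t p D g f hN (locOK_hs0_at κ Φ t p D g f hN hκ) (locOK_he_at κ Φ t p D g f hN hκ)

/-- **The rounds inequality**: `L0 ≤ sHi + (N+1)·(sLo − e)`. [folklore] -/
theorem hN₁ (κ : Consts) {V : Type} [DecidableEq V] [Countable V] {G : SimpleGraph V} [G.LocallyFinite] (Φ : PlanarSkeletonFrm G) (t : V) (p : unitInterval) (D : Skelφ.StepI.DataNS V) (g : ℕ) (f : ℕ) (hN : EqNumL κ Φ t p D g f) (hκ : (hL κ Φ t p D g f).natAbs ≤ 10 * nL κ Φ t p D g f) :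
    ((locPrm₁ κ Φ t p D g f).L0 : ℤ) ≤ (locPrm₁ κ Φ t p D g f).sHi + (((locPrm₁ κ Φ t p D g f).N : ℕ) + 1 : ℤ) * ((locPrm₁ κ Φ t p D g f).sLo - (locPrm₁ κ Φ t p D g f).e) :=
  hN_at κ Φ t p D g f (e_lt_sLo_at κ Φ t p D g f hN hκ)

/-- The slack and the kit radius, numerically: `z ≤ 12`, `e ≤ R′ + 12`, `R′ + 13 ≤ sLo`. [folklore] -/
theorem slack_facts (κ : Consts) {V : Type} [DecidableEq V] [Countable V] {G : SimpleGraph V} [G.LocallyFinite] (Φ : PlanarSkeletonFrm G) (t : V) (p : unitInterval) (D : Skelφ.StepI.DataNS V) (g : ℕ) (f : ℕ) (hN : EqNumL κ Φ t p D g f) (hκ : (hL κ Φ t p D g f).natAbs ≤ 10 * nL κ Φ t p D g f) :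
    zC κ Φ t p D g f ≤ 12 ∧ (locPrm₁ κ Φ t p D g f).e ≤ R' κ Φ t p D + 12 ∧ (R' κ Φ t p D : ℤ) + 13 ≤ (locPrm₁ κ Φ t p D g f).sLo := by
  have hz := zC_le κ Φ t p D g f hN hκ
  have hR' : (3 : ℤ) ≤ R' κ Φ t p D := by exact_mod_cast three_le_R' κ Φ t p D
  have h := le_aLo κ Φ t p D g f hN hκ (X := (R' κ Φ t p D : ℤ) + 14) (by positivity) (by linarith [ℓL_ge κ Φ t p D g f hN])
  refine ⟨hz, ?_, ?_⟩
  · show eC κ Φ t p D g f ≤ _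
    unfold eC; omega
  · show _ ≤ sLoC κ Φ t p D g f
    unfold sLoC; linarith

end CorrOK

end NegB

end PlanarSkeletonFrm

end Summit.CriticalPhenomena.PercolationContinuityZ3.Theorems.Transplant

end
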